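import Summits.HodgeConjecture.HodgeConjecture.Theorems.R90S4StableTransportDict      -- ★ p863911 (this seat, (B2-S) part 1): `IsStableTransportDict`, `isStablyConjGAt_of_isConj`, `cartanWeight` (brings ★ `IsEpsNormPair`, `IsStablyConjGAt`, the LH6 Weyl tower)
import HarnessLib

/-!
# R90-TF · S4 «Ch. 13.1–2», T-WIF road, letter TUBE-EQ — THE ε-TUBES OVER TWO MEMBERS OF THE CARTAN SYSTEM COINCIDE (ALONG A STABLE TRANSPORT) OR ARE DISJOINT
# (Rogawski 1990, §12.5 p. 186: «`{T}` a set of representatives for the stable conjugacy classes of Cartan subgroups … a set of representatives for the ε-conjugacy classes of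
# ε-regular elements»; §3.11 Prop. 3.11.1 pp. 34–35)

Cell `hodgecm-mathlib`, crux H413 (`stmt-HodgeConjecture-24833`, lane `--supports … --as helper`), route of record `HCCMUnconditional` (no route verbs;
count-neutral).  Programme R90-TF, section S4, dealer K2E2-plan (g7): letter TUBE-EQ of the T-WIF HEADS sheet v2 (`R90/R90-C131-p03/g2/HEADS-TWIF-tube.v2.md` §A6′, RULING S4-R27;
«yours now» 2026-09-05T01:11:05Z); seat K2E3-p12 (g10).  HEADS v2: «for `T_i, T_j ∈ C` the ε-tubes are EQUAL iff `T_i ∼_{st} T_j` (a (DICT) transport) and DISJOINT otherwise …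
hence the assembly partitions `G̃^{ε-reg}` by STABLE classes of Cartans, one tube per class, any representative» (v1's DISJ-ε «distinct members ⇒ disjoint tubes» was FALSE for
stably conjugate non-conjugate members).  THE TUBE LETTER (no `def`; ★ (A5) COVER-ε's second head verbatim): «`δ ∈ G̃_v` lies in the ε-tube over the member `T`» :=
`∃ t : ↥T, IsRegularElt (↑t).val ∧ IsEpsNormPair L (splitFormGL L) v δ ↑t` — `δ` has a NORM among the regular points of `T` (= «`δ` is ε-conjugate into `T̃^{ε-reg}`,
`T̃ = Cent_{G̃_v}(t)`» by ★ α A3 `exists_isEpsConj_epsNorm_eq_coe_of_isEpsNormPair` ∕ `isEpsNormPair_of_epsNorm_eq_coe`; ★ COVER-ε: every ε-regular `δ` lies in some member's tube).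

## CONTENTS (`G_v = Gqs L v = U(Φ₃)(L⁺_v) ⊂ G̃_v = GtLoc L v = GL₃(L ⊗ L⁺_v)`)
* §1 TUBES FOLLOW STABLE TRANSPORTS: `exists_norm_mem_of_transport` (a map `f : T → T′` with `f t ∼_{st} t` carries «norm in `T^{reg}`» to «norm in `T′^{reg}`»: norms form stable
  classes, ★ `IsEpsNormPair.of_isStablyConjGAt`, and regularity is a stable-class function); `isStablyConjGAt_symm_of_transport` (`e.symm` inherits clause (S));
  **`exists_norm_mem_iff_of_transport`** (`e : T ≃ₜ* T′` with (S) ⇒ the two tubes COINCIDE).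
* §2 `isStablyConjGAt_of_isEpsNormPair_of_isEpsNormPair` — two norms of one `δ` are stably conjugate (γ-side twin of ★ `isStablyEpsConjAt_of_isEpsNormPair`).
* §3 `conj_mul_comm_iff` (group lemma) and **`eq_of_isConj_of_mem_cartan`** — two members of a Cartan system (`hZ`, `hirr` of ★ CARTAN-ALL) containing CONJUGATE REGULAR elements
  are EQUAL (`Cent(t) = T` for regular `t ∈ T`, ★ `centralizer_eq_of_mem_centralizer_of_isRegularElt`; conjugation carries centralisers; `hirr`).
* §4 **`exists_transport_of_isStablyConjGAt_of_dict`** — under ★ `IsStableTransportDict L v C n`: if regular `t ∈ T_i` is stably conjugate to some `t′ ∈ T_j` then a stable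
  transport `e : T_i ≃ₜ* T_j` with (S) and (W) EXISTS (clause (B) lists `⟦t′⟧` among the `⟦e_{i,j′} t⟧`; §3 pins `T_{τ i j′} = T_j`).
* §5 **`tube_iff_or_disjoint_of_dict`** — THE DICHOTOMY: for members `T_i, T_j`, EITHER every `δ` lies in the tube over `T_i` iff it lies in the tube over `T_j`, OR no `δ` lies in
  both; with ★ COVER-ε the ε-regular set of `G̃_v` is thus partitioned by the STABLE classes of members (HEADS v2 §4′).

HONEST LABEL: HC_CM is proved only modulo the 7 printed citations (2 remaining named inputs: hLiu418 = stmt-HodgeConjecture-24832, h413 = stmt-HodgeConjecture-24833) until rung 0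
closes.  TUBE-EQ is ONE input of the (B1) T-WIF assembly behind the OPEN (W-NP) (others: (DICT)(1)(2), WEYL-ε, (WEYL-COUNT) T-side, J̃∕CMP′, (SING-ε)); group algebra, no
analysis.  REL ≠ ★ ≠ BUILT.  Theorems only; no instance, no notation, no `sorry`.

## References
* [Rogawski1990] J. D. Rogawski, *Automorphic Representations of Unitary Groups in Three Variables*, Ann. of Math. Stud. 123 (1990), §12.5 p. 186; §3.11 Prop. 3.11.1 pp. 34–35;
  §3.6 pp. 28–31.
-/

set_option autoImplicit false
set_option linter.dupNamespace false

noncomputable section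

open MeasureTheory Measure Set Filter Topology Function NumberField IsDedekindDomain
open Literature.MeasureTheory.Group
open Literature.NumberTheory.Automorphic Literature.NumberTheory.Automorphic.UnitaryGroup Literature.NumberTheory.Rogawski1990
open Literature.NumberTheory.Rogawski1990.Ch4Sec10
open Summit.HodgeConjecture.HodgeConjecture.Cruxes.H413
open Summit.HodgeConjecture.HodgeConjecture.Cruxes.H413.F0P3cStCharTSWeylCartanRadial
open scoped ENNReal NNReal MatrixGroups Pointwise

namespace Summit.HodgeConjecture.HodgeConjecture.R90.S4

section TubeEq

variable (L : Type) [Field L] [NumberField L] [IsCMField L] (v : HeightOneSpectrum (𝓞 ↥(maximalRealSubfield L)))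

/-! ## §1 Tubes follow stable transports -/

variable {L v} in
/-- **A stable transport carries the tube over `T` INTO the tube over `T′`**: if `f : T → T′` satisfies `f t ∼_{st} t` (clause (S)), then every `δ` with a norm among the regular
points of `T` has a norm among the regular points of `T′` (`f t`: norms form stable classes, ★ `IsEpsNormPair.of_isStablyConjGAt`; regularity is a stable-class function, ★
`isRegularElt_of_isConj`). [cite: Rogawski1990, §3.11 Prop. 3.11.1 (c) p. 34; §12.5 p. 186] -/
theorem exists_norm_mem_of_transport {T T' : Subgroup (Gqs L v)} (f : ↥T → ↥T')
    (hf : ∀ t : ↥T, IsStablyConjGAt L (R90.S4.splitFormGL L) v (t : Gqs L v) ((f t : ↥T') : Gqs L v)) {δ : GtLoc L v}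
    (h : ∃ t : ↥T, IsRegularElt (((t : Gqs L v)).val : GL (Fin 3) (LocalRing L v)) ∧ IsEpsNormPair L (R90.S4.splitFormGL L) v δ (t : Gqs L v)) :
    ∃ t' : ↥T', IsRegularElt (((t' : Gqs L v)).val : GL (Fin 3) (LocalRing L v)) ∧ IsEpsNormPair L (R90.S4.splitFormGL L) v δ (t' : Gqs L v) := by
  obtain ⟨t, ht, hδ⟩ := h
  exact ⟨f t, isRegularElt_of_isConj (hf t) ht, hδ.of_isStablyConjGAt (hf t)⟩

variable {L v} in
/-- The inverse of a stable transport `e : T ≃ₜ* T′` is a stable transport: `e⁻¹ t′ ∼_{st} t′`. [cite: Rogawski1990, §3.1 p. 19] -/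
theorem isStablyConjGAt_symm_of_transport {T T' : Subgroup (Gqs L v)} (e : ↥T ≃ₜ* ↥T')
    (he : ∀ t : ↥T, IsStablyConjGAt L (R90.S4.splitFormGL L) v (t : Gqs L v) ((e t : ↥T') : Gqs L v)) (t' : ↥T') :
    IsStablyConjGAt L (R90.S4.splitFormGL L) v (t' : Gqs L v) ((e.symm t' : ↥T) : Gqs L v) := by
  have h := he (e.symm t')
  rw [ContinuousMulEquiv.apply_symm_apply] at h
  exact IsConj.symm h

variable {L v} in
/-- **TUBES COINCIDE ALONG A STABLE TRANSPORT** (the «equal» half of TUBE-EQ): for `e : T ≃ₜ* T′` with `e t ∼_{st} t`, a `δ ∈ G̃_v` has a norm among the regular points of `T`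
iff it has one among the regular points of `T′`. [cite: Rogawski1990, §12.5 p. 186; §3.11 Prop. 3.11.1 (c) p. 34] -/
theorem exists_norm_mem_iff_of_transport {T T' : Subgroup (Gqs L v)} (e : ↥T ≃ₜ* ↥T')
    (he : ∀ t : ↥T, IsStablyConjGAt L (R90.S4.splitFormGL L) v (t : Gqs L v) ((e t : ↥T') : Gqs L v)) (δ : GtLoc L v) :
    (∃ t : ↥T, IsRegularElt (((t : Gqs L v)).val : GL (Fin 3) (LocalRing L v)) ∧ IsEpsNormPair L (R90.S4.splitFormGL L) v δ (t : Gqs L v)) ↔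
      ∃ t' : ↥T', IsRegularElt (((t' : Gqs L v)).val : GL (Fin 3) (LocalRing L v)) ∧ IsEpsNormPair L (R90.S4.splitFormGL L) v δ (t' : Gqs L v) :=
  ⟨exists_norm_mem_of_transport e he, exists_norm_mem_of_transport e.symm (isStablyConjGAt_symm_of_transport e he)⟩

/-! ## §2 Two norms of one element are stably conjugate -/

variable {L v} in
/-- **Two norms of one `δ` are stably conjugate** (`N δ ∼ γ` and `N δ ∼ γ′` in `G̃_v`): the γ-side twin of ★ `isStablyEpsConjAt_of_isEpsNormPair`.
[cite: Rogawski1990, §3.11 Prop. 3.11.1 (c) p. 34] -/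
theorem isStablyConjGAt_of_isEpsNormPair_of_isEpsNormPair {δ : GtLoc L v} {γ γ' : Gqs L v}
    (h : IsEpsNormPair L (R90.S4.splitFormGL L) v δ γ) (h' : IsEpsNormPair L (R90.S4.splitFormGL L) v δ γ') :
    IsStablyConjGAt L (R90.S4.splitFormGL L) v γ γ' :=
  IsConj.trans (IsConj.symm h) h'

/-! ## §3 Conjugate regular elements pin the member of the Cartan system -/

/-- Group lemma: `c a c⁻¹` commutes with `b` iff `a` commutes with `c⁻¹ b c`. [cite: Rogawski1990, §3.1 p. 19] -/
theorem conj_mul_comm_iff {G : Type} [Group G] (a b c : G) : c * a * c⁻¹ * b = b * (c * a * c⁻¹) ↔ a * (c⁻¹ * b * c) = c⁻¹ * b * c * a := by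
  constructor
  · intro h
    calc a * (c⁻¹ * b * c) = c⁻¹ * (c * a * c⁻¹ * b) * c := by group
      _ = c⁻¹ * (b * (c * a * c⁻¹)) * c := by rw [h]
      _ = c⁻¹ * b * c * a := by group
  · intro h
    calc c * a * c⁻¹ * b = c * (a * (c⁻¹ * b * c)) * c⁻¹ := by group
      _ = c * (c⁻¹ * b * c * a) * c⁻¹ := by rw [h]
      _ = b * (c * a * c⁻¹) := by group

variable {L v} in
/-- **Two members of a Cartan system containing CONJUGATE REGULAR elements are EQUAL.**  With the letters `hZ` (every member is `Cent(γ₀)`, `γ₀` regular) and `hirr` (distinct members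
are not conjugate) of ★ CARTAN-ALL: if `t ∈ T_i` is regular and conjugate to `t′ ∈ T_j`, then `T_i = Cent(t)`, `T_j = Cent(t′)` (★ `centralizer_eq_of_mem_centralizer_of_isRegularElt`)
and the conjugator carries one onto the other, so `hirr` forces `i = j`. [cite: Rogawski1990, §3.6 pp. 28–31; §3.1 p. 19] -/
theorem eq_of_isConj_of_mem_cartan {C : Finset (Subgroup (Gqs L v))}
    (hZ : ∀ T ∈ C, ∃ γ₀ : Gqs L v, IsRegularElt (γ₀.val : GL (Fin 3) (LocalRing L v)) ∧ T = Subgroup.centralizer ({γ₀} : Set (Gqs L v)))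
    (hirr : ∀ T ∈ C, ∀ T' ∈ C, T ≠ T' → ∀ y : Gqs L v, ¬ ∀ h : Gqs L v, h ∈ T' ↔ y⁻¹ * h * y ∈ T)
    {i j : ↥C} (t : ↥(i : Subgroup (Gqs L v))) (ht : IsRegularElt (((t : Gqs L v)).val : GL (Fin 3) (LocalRing L v))) (t' : ↥(j : Subgroup (Gqs L v)))
    (h : IsConj (t : Gqs L v) (t' : Gqs L v)) : i = j := by
  obtain ⟨c, hc⟩ := isConj_iff.mp h
  have ht' : IsRegularElt (((t' : Gqs L v)).val : GL (Fin 3) (LocalRing L v)) :=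
    isRegularElt_of_isConj (isStablyConjGAt_of_isConj h) ht
  obtain ⟨γ₁, hγ₁, hT₁⟩ := hZ i i.2
  obtain ⟨γ₂, hγ₂, hT₂⟩ := hZ j j.2
  have hZt : Subgroup.centralizer ({(t : Gqs L v)} : Set (Gqs L v)) = (i : Subgroup (Gqs L v)) :=
    (centralizer_eq_of_mem_centralizer_of_isRegularElt L v hγ₁ (hT₁.le t.2) ht).trans hT₁.symm
  have hZt' : Subgroup.centralizer ({(t' : Gqs L v)} : Set (Gqs L v)) = (j : Subgroup (Gqs L v)) :=
    (centralizer_eq_of_mem_centralizer_of_isRegularElt L v hγ₂ (hT₂.le t'.2) ht').trans hT₂.symm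
  by_contra hne
  refine hirr i i.2 j j.2 (fun heq => hne (Subtype.ext heq)) c fun g => ?_
  rw [← hZt, ← hZt', Subgroup.mem_centralizer_iff, Subgroup.mem_centralizer_iff]
  simp only [Set.mem_singleton_iff, forall_eq, ← hc]
  exact conj_mul_comm_iff (t : Gqs L v) g c

/-! ## §4 From the dictionary: stably related members are joined by a transport -/

variable {L v} in
/-- **Under the stable-transport dictionary, a member `T_j` meeting the stable class of a regular `t ∈ T_i` is the target of a stable transport `e : T_i ≃ₜ* T_j`** (with (S) and
(W)): clause (B) puts `⟦t′⟧` among the classes `⟦e_{i,j′} t⟧`, so `t′` is conjugate to the regular `e_{i,j′} t ∈ T_{τ i j′}`, and §3 pins `T_{τ i j′} = T_j`.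
[cite: Rogawski1990, §3.6 pp. 28–31; §12.5 pp. 182, 186] -/
theorem exists_transport_of_isStablyConjGAt_of_dict {C : Finset (Subgroup (Gqs L v))} {n : Gqs L v → ℕ} (hdict : IsStableTransportDict L v C n)
    (hZ : ∀ T ∈ C, ∃ γ₀ : Gqs L v, IsRegularElt (γ₀.val : GL (Fin 3) (LocalRing L v)) ∧ T = Subgroup.centralizer ({γ₀} : Set (Gqs L v)))
    (hirr : ∀ T ∈ C, ∀ T' ∈ C, T ≠ T' → ∀ y : Gqs L v, ¬ ∀ h : Gqs L v, h ∈ T' ↔ y⁻¹ * h * y ∈ T)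
    {i j : ↥C} (t : ↥(i : Subgroup (Gqs L v))) (ht : IsRegularElt (((t : Gqs L v)).val : GL (Fin 3) (LocalRing L v))) (t' : ↥(j : Subgroup (Gqs L v)))
    (h : IsStablyConjGAt L (R90.S4.splitFormGL L) v (t : Gqs L v) (t' : Gqs L v)) :
    ∃ e : ↥(i : Subgroup (Gqs L v)) ≃ₜ* ↥(j : Subgroup (Gqs L v)),
      (∀ s : ↥(i : Subgroup (Gqs L v)), IsStablyConjGAt L (R90.S4.splitFormGL L) v (s : Gqs L v) ((e s : ↥(j : Subgroup (Gqs L v))) : Gqs L v)) ∧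
      (∀ s : ↥(i : Subgroup (Gqs L v)), IsRegularElt (((s : Gqs L v)).val : GL (Fin 3) (LocalRing L v)) →
        cartanWeight L v (j : Subgroup (Gqs L v)) (e s) = cartanWeight L v (i : Subgroup (Gqs L v)) s) := by
  obtain ⟨m, τ, e, hS, hW, hB, -, -⟩ := hdict
  -- `⟦t′⟧` lies in the index set at `t`
  have hmem : ConjClasses.mk (t' : Gqs L v) ∈
      {c : ConjClasses (Gqs L v) | IsStablyConjGAt L (R90.S4.splitFormGL L) v (t : Gqs L v) (Quotient.out c)} := by
    have h1 : ConjClasses.mk (Quotient.out (ConjClasses.mk (t' : Gqs L v))) = ConjClasses.mk (t' : Gqs L v) := by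
      rw [← ConjClasses.quotient_mk_eq_mk, Quotient.out_eq]
    exact IsConj.trans h (isStablyConjGAt_of_isConj (ConjClasses.mk_eq_mk_iff_isConj.mp h1.symm))
  obtain ⟨j', -, hj'⟩ := (hB i t ht).surjOn hmem
  -- so `e_{i,j′} t` (regular, in `T_{τ i j′}`) is conjugate to `t′ ∈ T_j`: the members agree
  have hconj : IsConj ((e i j' t : ↥((τ i j' : ↥C) : Subgroup (Gqs L v))) : Gqs L v) (t' : Gqs L v) := ConjClasses.mk_eq_mk_iff_isConj.mp hj'
  have hreg : IsRegularElt ((((e i j' t : ↥((τ i j' : ↥C) : Subgroup (Gqs L v))) : Gqs L v)).val : GL (Fin 3) (LocalRing L v)) :=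
    isRegularElt_of_isConj (hS i j' t) ht
  have hτ : τ i j' = j := eq_of_isConj_of_mem_cartan hZ hirr (e i j' t) hreg t' hconj
  subst hτ
  exact ⟨e i j', hS i j', hW i j'⟩

/-! ## §5 TUBE-EQ: the dichotomy -/

/-- **TUBE-EQ (HEADS v2 §A6′).**  Under the stable-transport dictionary of a Cartan system `C` (with the `hZ`, `hirr` letters of ★ CARTAN-ALL), for any two members `T_i, T_j`:
EITHER the ε-tubes over `T_i` and `T_j` COINCIDE (every `δ ∈ G̃_v` has a norm in `T_i^{reg}` iff it has one in `T_j^{reg}` — the case of a stable transport `T_i ≃ₜ* T_j`, §4 + §1),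
OR they are DISJOINT (no `δ` has norms in both — else its two norms are stably conjugate, §2, and §4 applies).  With ★ COVER-ε `exists_mem_cartan_isEpsNormPair_of_isEpsRegularAt`
the ε-regular set of `G̃_v` is therefore partitioned by the STABLE classes of members of `C`, one tube per class, any representative. [cite: Rogawski1990, §12.5 p. 186; §3.11
Prop. 3.11.1 pp. 34–35; §3.6 pp. 28–31] -/
theorem tube_iff_or_disjoint_of_dict {C : Finset (Subgroup (Gqs L v))} {n : Gqs L v → ℕ} (hdict : IsStableTransportDict L v C n)
    (hZ : ∀ T ∈ C, ∃ γ₀ : Gqs L v, IsRegularElt (γ₀.val : GL (Fin 3) (LocalRing L v)) ∧ T = Subgroup.centralizer ({γ₀} : Set (Gqs L v)))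
    (hirr : ∀ T ∈ C, ∀ T' ∈ C, T ≠ T' → ∀ y : Gqs L v, ¬ ∀ h : Gqs L v, h ∈ T' ↔ y⁻¹ * h * y ∈ T) (i j : ↥C) :
    (∀ δ : GtLoc L v,
      (∃ t : ↥(i : Subgroup (Gqs L v)), IsRegularElt (((t : Gqs L v)).val : GL (Fin 3) (LocalRing L v)) ∧ IsEpsNormPair L (R90.S4.splitFormGL L) v δ (t : Gqs L v)) ↔
        ∃ t' : ↥(j : Subgroup (Gqs L v)), IsRegularElt (((t' : Gqs L v)).val : GL (Fin 3) (LocalRing L v)) ∧ IsEpsNormPair L (R90.S4.splitFormGL L) v δ (t' : Gqs L v)) ∨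
    (∀ δ : GtLoc L v,
      ¬ ((∃ t : ↥(i : Subgroup (Gqs L v)), IsRegularElt (((t : Gqs L v)).val : GL (Fin 3) (LocalRing L v)) ∧ IsEpsNormPair L (R90.S4.splitFormGL L) v δ (t : Gqs L v)) ∧
        ∃ t' : ↥(j : Subgroup (Gqs L v)), IsRegularElt (((t' : Gqs L v)).val : GL (Fin 3) (LocalRing L v)) ∧ IsEpsNormPair L (R90.S4.splitFormGL L) v δ (t' : Gqs L v))) := by
  by_cases hmeet : ∃ δ : GtLoc L v,
      (∃ t : ↥(i : Subgroup (Gqs L v)), IsRegularElt (((t : Gqs L v)).val : GL (Fin 3) (LocalRing L v)) ∧ IsEpsNormPair L (R90.S4.splitFormGL L) v δ (t : Gqs L v)) ∧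
        ∃ t' : ↥(j : Subgroup (Gqs L v)), IsRegularElt (((t' : Gqs L v)).val : GL (Fin 3) (LocalRing L v)) ∧ IsEpsNormPair L (R90.S4.splitFormGL L) v δ (t' : Gqs L v)
  · obtain ⟨δ, ⟨t, ht, hδt⟩, ⟨t', -, hδt'⟩⟩ := hmeet
    obtain ⟨e, he, -⟩ := exists_transport_of_isStablyConjGAt_of_dict hdict hZ hirr t ht t' (isStablyConjGAt_of_isEpsNormPair_of_isEpsNormPair hδt hδt')
    exact Or.inl fun δ' => exists_norm_mem_iff_of_transport e he δ'
  · exact Or.inr fun δ hδ => hmeet ⟨δ, hδ⟩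

end TubeEq

end Summit.HodgeConjecture.HodgeConjecture.R90.S4

end
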